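import Literature.IUT.HodgeTheaters.KitCoreBridge
import Literature.IUT.HodgeTheaters.ThetaNFHodgeTheatersProofs2
import Literature.IUT.HodgeTheaters.ThetaHodgeTheatersCor56iSub
import HarnessLib

/-!
# The ℱ-level §5-R4 ↔ §5/§6 kit dictionary `FKitCore(S, 𝔉K)` over `KitCore(K, 𝔡)`, and [IUTchI] Cor 5.6 (i)
# for abc-iut-L5-t3's Θ-Hodge theaters FROM the kit-level rows (intra-layer merge C9-h, ℱ-side; bridge + proofs)

S. Mochizuki, *Inter-universal Teichmüller theory I*, kurims manuscript (May 2020): Definition 5.2 (i) p. 134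
("`‡ℱ_v` is a category `‡𝒞_v` which admits an equivalence of categories `‡𝒞_v ⥲ 𝒞_v` … / a collection of data …
such that there exists an isomorphism of collections of data `‡ℱ_v ⥲ ℱ_v`"), Remark 5.2.1 (i) p. 143 ("a
functorial algorithm for constructing `𝒟`- … prime-strips from `ℱ`- … prime-strips"), Definition 3.6 / Remark
3.6.2 pp. 87–88 (Θ-Hodge theaters and their isomorphisms), the discussion preceding Example 5.4 p. 147 ("the
`ℱ`-prime-strip tautologically associated to this Θ-Hodge theater … `†𝔇_>` may be identified with the
`𝒟`-prime-strip associated to `†𝔉_>`"), Corollary 5.6 (i) p. 153 with its proof p. 154 l. 8–24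
([IUTchI] Cor 5.6 (i) p.153) [claim: Mochizuki2012, status: disputed] (D-0012 claim key, series status
DISPUTED — this file is a DICTIONARY between two landed typings of the cell plus proofs; nothing of the series
is asserted and no side is taken on [IUTchIII] Cor. 3.12).

## Why this file exists (plan/L5/SUBDAG-IUTchI-Cor56i.md "Junction to the node … nobody owes that bridge")

Layer L5 typed [IUTchI] §5 (Example 5.4 – Corollary 5.6) TWICE: abc-iut-L5-t3 over the hypothesis structure
`BaseThetaDatum.S5Local 𝔡` (`FrobenioidBridgeModels.lean`: ambient categories `FAmb v` of isomorphs of `ℱ_v`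
with the base functor `base v : FAmb v ⥤ Amb v` of Rmk 5.2.1 (i), an OPAQUE groupoid `ThetaHT` of Θ-Hodge
theaters with `assocStrip`/`assocStripIso`), where the node statement `S5Local.Cor56i S` lives
(`ThetaNFHodgeTheaters.lean`, FROZEN G22) together with its conditional discharge
`cor56i_of_rigid (hHT) (hbase)` (`ThetaNFHodgeTheatersProofs2.lean`); and abc-iut-L5-t4 over the STRUCTURED kit
`PMBaseKit.FKit` (`FPrimeStrips.lean`: `FAmb`, `toD`, structured `ThetaHT`/`ThetaHT.Iso`, `fStrip`), where
abc-iut-w5-d217 cut the printed proof into rows and PROVED `isoToF_bijective_of_rows` / `cor56iKit_of`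
(`ThetaHodgeTheatersCor56iSub.lean`) and abc-iut-L5-d4 PROVED `model_bijective_of_isomFtoDBijective`
(`FPrimeStripsRigidity.lean`).  This file supplies the ℱ-level junction, on top of the `𝒟`-level dictionary
`BaseThetaDatum.KitCore` (`KitCoreBridge.lean`):

* `S5Local.FKitCore S c FK` — a HYPOTHESIS STRUCTURE whose fields quote print: at each kit place a fully
  faithful functor `S.FAmb (e x) ⥤ FK.FAmb x` (the isomorphs of `ℱ_v` of Def 5.2 (i) on both sides) carrying
  the model to the model, INTERTWINING the two base functors `𝔉 ↦ 𝔇` of Rmk 5.2.1 (i) through the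
  `𝒟`-level comparison functor of `KitCore` (`baseComm`); a comparison of Θ-Hodge theaters `ht` which is a
  bijection on isomorphisms (Def 3.6 / Rmk 3.6.2 typed twice), under which abc-iut-L5-t3's "tautologically
  associated" `ℱ`-prime-strip `assocStrip` IS abc-iut-L5-t4's `ThetaHT.fStrip`, naturally in isomorphisms
  (`assocIso`, `assoc_natural`).  No field asserts a result of the series.
* **Junction theorems** (all PROVED): `base_mapIso_bijective_of_model` / `hbase_of_isomFtoDBijective` — the
  kit node `IsomFtoDBijective` (Cor 5.3 (ii)) yields abc-iut-L5-t3's `hbase`; `assocStripIso_bijective_of_isoToF`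
  — bijectivity of `ThetaHT.isoToF` (abc-iut-w5-d217's `isoToF_bijective_of_rows`) yields abc-iut-L5-t3's
  `hHT`; hence **`cor56i_of_rows`** and **`cor56i_of_cor56iKit`**: for every `S5Local` that core-agrees with an
  `FKit` over a kit indexed by all of `𝕍`, the FROZEN node statement `S5Local.Cor56i S` follows from the kit rows
  L02–L05 of the sub-DAG, resp. from `Cor56iKit FK` + `IsomFtoDBijective FK`, BY NAME.

NOT here: the global (`ℱ^⊚`, `ℱ^⊛`, `φ^NF`) half of the dictionary needed to instantiate abc-iut-L5-t5's ΘNF-side kit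
`PMBaseKit.S5Local` (Def 5.5 (iii)) from abc-iut-L5-t3's ΘNF-Hodge theaters, and the local `∞κ`-coric data
(abc-iut-L5-t4's `CoricKit`) over which Example 5.4 (iv)'s compatibility clause (p. 149) is to be typed — both
are further fields of the full merge; a KIT-RULE inhabitant of `FKitCore` is owed as a companion (pattern of
`KitCoreBridgeWitness.lean`).  typed ≠ proved elsewhere; here every `theorem` is kernel-checked.
-/

namespace Literature.IUT.HodgeTheaters

open CategoryTheory

universe u

/-! ### Fully faithful functors are bijective on isomorphisms (category-theory plumbing) -/

/-- A fully faithful functor induces a bijection `Iso(X, Y) → Iso(FX, FY)` (Mathlib plumbing: `preimageIso`).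
[folklore] -/
private theorem fullyFaithful_mapIso_bijective {C D : Type*} [Category C] [Category D] {F : C ⥤ D}
    (hF : F.FullyFaithful) (X Y : C) : Function.Bijective (F.mapIso : (X ≅ Y) → (F.obj X ≅ F.obj Y)) := by
  refine ⟨fun a b h => Iso.ext (hF.map_injective (congrArg Iso.hom h)), fun e => ⟨hF.preimageIso e, ?_⟩⟩
  ext
  simp [Functor.FullyFaithful.preimageIso]

/-- Conjugation by fixed isomorphisms is a bijection `Iso(X, Y) → Iso(X', Y')` (Mathlib plumbing). [folklore] -/
private theorem iso_conj_bijective {C : Type*} [Category C] {X X' Y Y' : C} (a : X ≅ X') (b : Y ≅ Y') :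
    Function.Bijective fun φ : X ≅ Y => a.symm ≪≫ φ ≪≫ b := by
  refine ⟨fun φ ψ h => ?_, fun θ => ⟨a ≪≫ θ ≪≫ b.symm, by ext; simp⟩⟩
  have h' := congrArg (fun θ => a ≪≫ θ ≪≫ b.symm) h
  simpa using h'

namespace BaseThetaDatum.S5Local

variable {𝔡 : BaseThetaDatum.{u}} (S : S5Local 𝔡) {K : PMBaseKit.{u} 𝔡.l} (c : 𝔡.KitCore K)
  {M : K.MultKit} (FK : K.FKit M)

/-! ### The ℱ-level core agreement -/

/-- **`FKitCore(S, 𝔉K)` — the core agreement of abc-iut-L5-t3's §5-R4 data `S : S5Local 𝔡` with abc-iut-L5-t4's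
`ℱ`-prime-strip kit `FK : K.FKit M`, over a `𝒟`-level core agreement `c : KitCore 𝔡 K`** (merge canon C9-h,
ℱ-side).  [IUTchI] Def 5.2 (i) p. 134 takes the constituents `‡ℱ_v` of an `ℱ`-prime-strip to be the isomorphs of
the model `ℱ_v` of Examples 3.2 (iii), 3.3 (i), 3.4 (i) — on both sides of the dictionary — with Rmk 5.2.1 (i)'s
functorial passage `𝔉 ↦ 𝔇` to the associated `𝒟`-prime-strip (`S.base`, resp. `FK.toD`); Def 3.6 / Rmk 3.6.2
define Θ-Hodge theaters and their isomorphisms, typed as an opaque groupoid `S.ThetaHT` resp. as the structured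
`FK.ThetaHT`/`ThetaHT.Iso`; p. 147 attaches to a Θ-Hodge theater "the `ℱ`-prime-strip tautologically associated"
(`S.assocStrip`, resp. `ThetaHT.fStrip`).  Rendered between the two typings: fully faithful comparison functors
of the local ambient categories carrying model to model and intertwining the base functors through the `𝒟`-level
comparison, and a comparison of Θ-Hodge theaters bijective on isomorphisms under which the associated
`ℱ`-prime-strips correspond naturally.  A HYPOTHESIS STRUCTURE (no field asserts a result of the series).
([IUTchI] Def 5.2 (i) p.134) [claim: Mochizuki2012, status: disputed] -/
structure FKitCore where
  /-- Def 5.2 (i): the isomorphs `‡ℱ_v` of `ℱ_v` (objects of `S.FAmb v`, `v = e x`) are objects of the kit's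
  ambient category at `x`, with the same morphisms … -/
  famb : ∀ x : K.V, S.FAmb (c.e x) ⥤ FK.FAmb x
  /-- … "the same morphisms": the comparison functor is fully faithful … -/
  fambFF : ∀ x : K.V, (famb x).FullyFaithful
  /-- … and the model `ℱ_v` (Examples 3.2 (iii), 3.3 (i), 3.4 (i)) goes to the kit's model `ℱ_v`. -/
  fambModel : ∀ x : K.V, (famb x).obj (S.F (c.e x)) ≅ FK.fModel x
  /-- Rmk 5.2.1 (i): the associated base object `†𝒟_v` of `†ℱ_v` is THE SAME on both sides — the two base
  functors are intertwined by the comparison functors (`S.base ⋙ c.amb ≅ famb ⋙ FK.toD`). -/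
  baseComm : ∀ x : K.V, S.base (c.e x) ⋙ c.amb x ≅ famb x ⋙ FK.toD x
  /-- Def 3.6: a Θ-Hodge theater of abc-iut-L5-t3's opaque groupoid IS a structured Θ-Hodge theater of the kit … -/
  ht : S.ThetaHT → FK.ThetaHT
  /-- … Rmk 3.6.2: isomorphisms of Θ-Hodge theaters correspond … -/
  htIso : ∀ {X Y : S.ThetaHT}, (X ≅ Y) → PMBaseKit.FKit.ThetaHT.Iso (ht X) (ht Y)
  /-- … bijectively (the two typings of `Isom(†ℋ𝒯^Θ, ‡ℋ𝒯^Θ)` agree). -/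
  htIso_bijective : ∀ X Y : S.ThetaHT,
    Function.Bijective (htIso : (X ≅ Y) → PMBaseKit.FKit.ThetaHT.Iso (ht X) (ht Y))
  /-- p. 147: "the `ℱ`-prime-strip tautologically associated to this Θ-Hodge theater" is the same on both sides
  (`S.assocStrip X` read in the kit is `(ht X).fStrip`) … -/
  assocIso : ∀ (X : S.ThetaHT) (x : K.V), (famb x).obj (S.assocStrip X (c.e x)) ≅ (FK.thToF x).obj ((ht X).th x)
  /-- … naturally in isomorphisms of Θ-Hodge theaters ("the natural functorially induced map", Cor 5.6 (i)). -/
  assoc_natural : ∀ {X Y : S.ThetaHT} (φ : X ≅ Y) (x : K.V),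
    (famb x).map (S.assocStripIso φ (c.e x)).hom ≫ (assocIso Y x).hom =
      (assocIso X x).hom ≫ ((FK.thToF x).mapIso ((htIso φ).thIso x)).hom

namespace FKitCore

variable {S c FK}

/-! ### The `hbase` input of `cor56i_of_rigid` from the kit: Cor 5.3 (ii) -/

/-- Every object of abc-iut-L5-t3's `FAmb v` is, in the kit, an isomorph of the kit's model `ℱ_v` (Def 5.2 (i)).
([IUTchI] Def 5.2 (i) p.134) [claim: Mochizuki2012, status: disputed] -/
noncomputable def isoModel (fc : S.FKitCore c FK) (x : K.V) (A : S.FAmb (c.e x)) : (fc.famb x).obj A ≅ FK.fModel x :=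
  (fc.famb x).mapIso (S.nonempty_isoF _ A (S.F (c.e x))).some ≪≫ fc.fambModel x

/-- Rmk 5.2.1 (i) through the dictionary: on isomorphisms `φ : A ⥲ B` of isomorphs of `ℱ_v`, the base functor of
abc-iut-L5-t3 followed by the `𝒟`-level comparison is CONJUGATE, by `baseComm`, to the kit's base functor applied
after the ℱ-level comparison. ([IUTchI] Rmk 5.2.1 (i) p.143) [claim: Mochizuki2012, status: disputed] -/
theorem amb_mapIso_base_mapIso (fc : S.FKitCore c FK) (x : K.V) {A B : S.FAmb (c.e x)} (φ : A ≅ B) :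
    (c.amb x).mapIso ((S.base (c.e x)).mapIso φ) =
      (fc.baseComm x).app A ≪≫ (FK.toD x).mapIso ((fc.famb x).mapIso φ) ≪≫ ((fc.baseComm x).app B).symm := by
  ext
  change (S.base (c.e x) ⋙ c.amb x).map φ.hom =
    (fc.baseComm x).hom.app A ≫ (fc.famb x ⋙ FK.toD x).map φ.hom ≫ (fc.baseComm x).inv.app B
  exact (NatIso.naturality_2 (fc.baseComm x) φ.hom).symm

/-- **Cor 5.3 (ii) at the model ⇒ abc-iut-L5-t3's `hbase` at a kit place**: if the natural map
`Isom(ℱ_v, ℱ_v) → Isom(𝒟_v, 𝒟_v)` on the kit's MODEL is bijective (abc-iut-L5-d4's model form of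
`IsomFtoDBijective`), then for all isomorphs `A`, `B` of `ℱ_v` in abc-iut-L5-t3's ambient category the map
`Isom(A, B) → Isom(𝒟(A), 𝒟(B))` induced by `S.base` is bijective (functoriality of `𝔉 ↦ 𝔇`, Rmk 5.2.1 (i),
transported along the fully faithful comparison functors). ([IUTchI] Cor 5.3 (ii) p.144) [claim: Mochizuki2012, status: disputed] -/
theorem base_mapIso_bijective_of_model (fc : S.FKitCore c FK) (x : K.V)
    (h : Function.Bijective fun α : FK.fModel x ≅ FK.fModel x => (FK.toD x).mapIso α)
    (A B : S.FAmb (c.e x)) :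
    Function.Bijective ((S.base (c.e x)).mapIso : (A ≅ B) → ((S.base (c.e x)).obj A ≅ (S.base (c.e x)).obj B)) := by
  -- the composite `amb.mapIso ∘ base.mapIso` is `conj ∘ toD.mapIso ∘ famb.mapIso`, a composite of bijections
  have h1 : Function.Bijective ((fc.famb x).mapIso : (A ≅ B) → _) := fullyFaithful_mapIso_bijective (fc.fambFF x) A B
  have h2 : Function.Bijective fun φ : (fc.famb x).obj A ≅ (fc.famb x).obj B => (FK.toD x).mapIso φ :=
    PMBaseKit.FKit.mapIso_bijective_of_model x h (fc.isoModel x A) (fc.isoModel x B)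
  have h3 : Function.Bijective fun θ : (FK.toD x).obj ((fc.famb x).obj A) ≅ (FK.toD x).obj ((fc.famb x).obj B) =>
      ((fc.baseComm x).app A).symm.symm ≪≫ θ ≪≫ ((fc.baseComm x).app B).symm :=
    iso_conj_bijective ((fc.baseComm x).app A).symm ((fc.baseComm x).app B).symm
  have h4 : Function.Bijective ((c.amb x).mapIso :
      ((S.base (c.e x)).obj A ≅ (S.base (c.e x)).obj B) → _) := fullyFaithful_mapIso_bijective (c.ambFF x) _ _
  have hcomp : (c.amb x).mapIso ∘ ((S.base (c.e x)).mapIso : (A ≅ B) → _) =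
      (fun θ => ((fc.baseComm x).app A).symm.symm ≪≫ θ ≪≫ ((fc.baseComm x).app B).symm) ∘
        (fun φ => (FK.toD x).mapIso φ) ∘ ((fc.famb x).mapIso : (A ≅ B) → _) := by
    funext φ
    simp only [Function.comp_apply, Iso.symm_symm_eq]
    exact fc.amb_mapIso_base_mapIso x φ
  have hc : Function.Bijective ((c.amb x).mapIso ∘ ((S.base (c.e x)).mapIso : (A ≅ B) → _)) := by
    rw [hcomp]; exact h3.comp (h2.comp h1)
  exact ⟨fun a b hab => hc.1 (congrArg (c.amb x).mapIso hab),
    fun ψ => by obtain ⟨φ, hφ⟩ := hc.2 ((c.amb x).mapIso ψ); exact ⟨φ, h4.1 hφ⟩⟩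

/-- **The kit node `IsomFtoDBijective` (Cor 5.3 (ii)) ⇒ abc-iut-L5-t3's `hbase`**, for kits indexed by all of `𝕍`:
every `ℱ_v` is rigid over its base `𝒟_v`, constituent-wise, at every place of the §4 datum.
([IUTchI] Cor 5.3 (ii) p.144) [claim: Mochizuki2012, status: disputed] -/
theorem hbase_of_isomFtoDBijective (fc : S.FKitCore c FK) (he : Function.Surjective c.e) (h53ii : FK.IsomFtoDBijective)
    (v : 𝔡.V) (A B : S.FAmb v) :
    Function.Bijective ((S.base v).mapIso : (A ≅ B) → ((S.base v).obj A ≅ (S.base v).obj B)) := by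
  obtain ⟨x, rfl⟩ := he v
  exact fc.base_mapIso_bijective_of_model x (PMBaseKit.FKit.model_bijective_of_isomFtoDBijective h53ii x) A B

/-! ### The `hHT` input of `cor56i_of_rigid` from the kit: isomorphisms of Θ-Hodge theaters -/

/-- `assoc_natural` as an identity of isomorphisms: abc-iut-w5-d217's `ThetaHT.isoToF` of the transported
isomorphism of Θ-Hodge theaters is the conjugate, by the identifications `assocIso`, of abc-iut-L5-t3's
`assocStripIso` read in the kit. ([IUTchI] Cor 5.6 (i) p.153) [claim: Mochizuki2012, status: disputed] -/
theorem isoToF_htIso (fc : S.FKitCore c FK) {X Y : S.ThetaHT} (φ : X ≅ Y) (x : K.V) :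
    PMBaseKit.FKit.ThetaHT.isoToF (fc.htIso φ) x =
      (fc.assocIso X x).symm ≪≫ (fc.famb x).mapIso (S.assocStripIso φ (c.e x)) ≪≫ fc.assocIso Y x := by
  ext
  change (FK.thToF x).map ((fc.htIso φ).thIso x).hom =
    (fc.assocIso X x).inv ≫ (fc.famb x).map (S.assocStripIso φ (c.e x)).hom ≫ (fc.assocIso Y x).hom
  rw [fc.assoc_natural φ x, Iso.inv_hom_id_assoc, Functor.mapIso_hom]

/-- **Bijectivity of `ThetaHT.isoToF` on the kit ⇒ abc-iut-L5-t3's `hHT`**, for kits indexed by all of `𝕍`: if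
isomorphisms of the kit's structured Θ-Hodge theaters correspond bijectively to isomorphisms of their associated
`ℱ`-prime-strips (abc-iut-w5-d217's `isoToF_bijective_of_rows`, p. 154 l. 8–20), then isomorphisms of
abc-iut-L5-t3's Θ-Hodge theaters correspond bijectively to families of isomorphisms of the constituents of their
tautologically associated `ℱ`-prime-strips. ([IUTchI] Cor 5.6 (i) p.154) [claim: Mochizuki2012, status: disputed] -/
theorem assocStripIso_bijective_of_isoToF (fc : S.FKitCore c FK) (he : Function.Surjective c.e)
    (hF : ∀ H₁ H₂ : FK.ThetaHT, Function.Bijective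
      (PMBaseKit.FKit.ThetaHT.isoToF : PMBaseKit.FKit.ThetaHT.Iso H₁ H₂ → H₁.fStrip.Iso H₂.fStrip))
    (X Y : S.ThetaHT) :
    Function.Bijective (fun e : X ≅ Y => fun v => S.assocStripIso e v) := by
  have hΦ : Function.Bijective fun e : X ≅ Y => PMBaseKit.FKit.ThetaHT.isoToF (fc.htIso e) :=
    (hF _ _).comp (fc.htIso_bijective X Y)
  constructor
  · intro e₁ e₂ h
    apply hΦ.1
    funext x
    change PMBaseKit.FKit.ThetaHT.isoToF (fc.htIso e₁) x = PMBaseKit.FKit.ThetaHT.isoToF (fc.htIso e₂) x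
    rw [fc.isoToF_htIso, fc.isoToF_htIso, show S.assocStripIso e₁ (c.e x) = S.assocStripIso e₂ (c.e x) from
      congrFun h (c.e x)]
  · intro a
    obtain ⟨e, he'⟩ := hΦ.2 fun x => (fc.assocIso X x).symm ≪≫ (fc.famb x).mapIso (a (c.e x)) ≪≫ fc.assocIso Y x
    refine ⟨e, funext fun v => ?_⟩
    obtain ⟨x, rfl⟩ := he v
    have hx := congrFun he' x
    change PMBaseKit.FKit.ThetaHT.isoToF (fc.htIso e) x = _ at hx
    rw [fc.isoToF_htIso] at hx
    have hx' := (iso_conj_bijective (fc.assocIso X x) (fc.assocIso Y x)).1 hx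
    exact (fullyFaithful_mapIso_bijective (fc.fambFF x) _ _).1 hx'

/-! ### [IUTchI] Cor 5.6 (i) for abc-iut-L5-t3's Θ-Hodge theaters, from the kit -/

/-- **[IUTchI] Cor 5.6 (i) (the FROZEN node statement `S5Local.Cor56i S`) FROM THE KIT ROWS**: for every `S5Local`
that core-agrees (`FKitCore`, over a `KitCore` indexed by all of `𝕍`) with an `ℱ`-prime-strip kit satisfying rows
L02 (`ThToFBijOnGood`), L04 = Cor 5.3 (ii) (`IsomFtoDBijective`), L05 = Cor 5.3 (iv) (`AutTemperedBijective`) and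
L03 (`RlfDetermined`) of plan/L5/SUBDAG-IUTchI-Cor56i.md, "the natural functorially induced map from the set of
isomorphisms between two Θ-Hodge theaters to the set of isomorphisms between the respective associated
`𝒟`-prime-strips is bijective" HOLDS for abc-iut-L5-t3's Θ-Hodge theaters — abc-iut-w5-d217's
`isoToF_bijective_of_rows` supplies `hHT`, abc-iut-L5-d4's `model_bijective_of_isomFtoDBijective` supplies `hbase`,
and abc-iut-L5-t3's `cor56i_of_rigid` concludes.  CONDITIONAL on the four kit rows (typed ≠ proved for the real
kit). ([IUTchI] Cor 5.6 (i) p.153) [claim: Mochizuki2012, status: disputed] -/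
theorem cor56i_of_rows (fc : S.FKitCore c FK) (he : Function.Surjective c.e) (h02 : FK.ThToFBijOnGood)
    (h53ii : FK.IsomFtoDBijective) (h53iv : FK.AutTemperedBijective) (h03 : FK.RlfDetermined) :
    Cor56i S :=
  cor56i_of_rigid S
    (fc.assocStripIso_bijective_of_isoToF he
      (PMBaseKit.FKit.isoToF_bijective_of_rows h02 h53ii h53iv h03))
    (fc.hbase_of_isomFtoDBijective he h53ii)

/-- **[IUTchI] Cor 5.6 (i): the kit form (`Cor56iKit FK`, abc-iut-w5-d217) together with Cor 5.3 (ii)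
(`IsomFtoDBijective FK`) IMPLIES the frozen node statement `S5Local.Cor56i S`** for every `S5Local` core-agreeing
with the kit over all of `𝕍`: the kit's natural map `Isom(†ℋ𝒯^Θ, ‡ℋ𝒯^Θ) → Isom(†𝔇_>, ‡𝔇_>)` factors as
`Isom(†𝔉_>, ‡𝔉_>) → Isom(†𝔇_>, ‡𝔇_>)` after `isoToF` (row L01, `isoToD_eq_assocDMap_isoToF`), so with Cor 5.3 (ii)
`isoToF` is bijective, which is `hHT`; `hbase` as above. ([IUTchI] Cor 5.6 (i) p.153) [claim: Mochizuki2012, status: disputed] -/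
theorem cor56i_of_cor56iKit (fc : S.FKitCore c FK) (he : Function.Surjective c.e) (hK : FK.Cor56iKit)
    (h53ii : FK.IsomFtoDBijective) : Cor56i S := by
  refine cor56i_of_rigid S (fc.assocStripIso_bijective_of_isoToF he fun H₁ H₂ => ?_)
    (fc.hbase_of_isomFtoDBijective he h53ii)
  -- `isoToD = assocDMap ∘ isoToF` with `isoToD` bijective (Cor56iKit) and `assocDMap` bijective (Cor 5.3 (ii))
  have hfac : (PMBaseKit.FKit.ThetaHT.isoToD : PMBaseKit.FKit.ThetaHT.Iso H₁ H₂ → H₁.dStrip.Iso H₂.dStrip) =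
      PMBaseKit.FKit.FStrip.assocDMap ∘
        (PMBaseKit.FKit.ThetaHT.isoToF : PMBaseKit.FKit.ThetaHT.Iso H₁ H₂ → H₁.fStrip.Iso H₂.fStrip) :=
    funext PMBaseKit.FKit.ThetaHT.isoToD_eq_assocDMap_isoToF
  have hD := hK H₁ H₂
  rw [hfac] at hD
  exact ⟨Function.Injective.of_comp hD.1,
    fun t => by obtain ⟨φ, hφ⟩ := hD.2 (PMBaseKit.FKit.FStrip.assocDMap t); exact ⟨φ, (h53ii _ _).1 hφ⟩⟩

end FKitCore

end BaseThetaDatum.S5Local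

end Literature.IUT.HodgeTheaters
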